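import Literature.MathematicalPhysics.QuantumLattice.XYOrderGDProofs

/-!
# Route `AnisotropyChord`, support `SectorAnchorXY` (stmt-HubbardSuperconductivity-0977) — part 2:
# reflection positivity with a chemical potential

For the quantum XY model `H = xyTorus d L n` on the even torus (`L` even, `L ≥ 3`), a pair of
reflection planes `P = (j, a)` with left half `Λ_L = torusLeftHalf L j a`, the magnetisation
imbalance `X = S³_{Λ_L} - S³_{Λ ∖ Λ_L}` and the total magnetisation `S³_tot`:

  `½ E₀(H - μX) + ½ E₀(H + μX) ≤ E₀(H - μ S³_tot)`   (`groundEnergy_chemPot_reflect_le`).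

Proof: after the Kennedy–Lieb–Shastry sublattice rotation `W` (`π` about the `1`-axis on the odd
sublattice: `S³_x ↦ ε_x S³_x`, `H ↦ H♭ = H♭(0)`; `exists_sublatticeRotation`, rebuilt from the
tree's `groundEnergy_xyFieldHamiltonian_eq`) and the tensor-square identification along `θ`
(`xyRealFieldHamiltonian_eq_submatrix` at field `0`), `W(H - μS³_tot)Wᴴ` is the Kronecker form
`K(A - μq, A + μq, M, M)` and `W(H ∓ μX)Wᴴ` are `K(A ∓ μq, A ∓ μq, M, M)`, where `A = H^L`,
`M` are the real crossing operators and `q = Σ_{x ∈ Λ_L} ε_x S³_x` (the reflection `θ` exchanges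
the sublattices, `ε_{θx} = -ε_x`); the abstract ground-state reflection positivity
`Matrix.kls_groundEnergy_reflection` (KLS, J. Stat. Phys. 53 (1988), eqs. (20)–(25)) concludes.
Dyson–Lieb–Simon (1978) §3 / Kennedy–Lieb–Shastry (1988) technique; no definition is introduced.
-/

-- the mandated namespace `Summit.<Summit>.<Problem>.Theorems` repeats `HubbardSuperconductivity`
set_option linter.dupNamespace false

noncomputable section

namespace Summit.HubbardSuperconductivity.HubbardSuperconductivity.Theorems.AnisotropyChord

open Matrix Finset Literature.MathematicalPhysics.QuantumLattice Literature.Probability.LatticeModels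
open scoped ComplexOrder Kronecker

variable {d : ℕ}

/-! ### The sublattice rotation -/

/-- In `ℤ/2ℤ`: `2t + 1 - c = c + 1`. [folklore] -/
theorem zmod_two_reflect (c t : ZMod 2) : 2 * t + 1 - c = c + 1 := by
  revert c t; decide

/-- **The Kennedy–Lieb–Shastry sublattice rotation**, with its action on `S³`: on the even torus
there are a product unitary `W` (rotation by `π` about the `1`-axis on the odd sublattice) and
signs `ε_x = ±1` (`+1` on the even, `-1` on the odd sublattice, exchanged by every reflection
between sites) with `W H Wᴴ = H♭(0)` and `W S³_x Wᴴ = ε_x S³_x`. Kennedy–Lieb–Shastry, J. Stat.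
Phys. 53 (1988), eqs. (15)–(17); Dyson–Lieb–Simon (1978) §3. [folklore] -/
theorem exists_sublatticeRotation (k : ℕ) [NeZero (2 * k)] (n : ℕ) :
    ∃ (W : Op (TorusSite d (2 * k)) (n + 1)) (sgn : TorusSite d (2 * k) → ℂ),
      W * Wᴴ = 1 ∧ Wᴴ * W = 1 ∧
      W * xyTorus d (2 * k) n * Wᴴ = xyRealFieldHamiltonian (2 * k) n 0 ∧
      (∀ x, W * siteSpin n x 2 * Wᴴ = sgn x • siteSpin n x 2) ∧
      (∀ x, sgn x = 1 ∨ sgn x = -1) ∧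
      (∀ (j : Fin d) (a : ZMod (2 * k)) (x : TorusSite d (2 * k)),
        sgn (Torus.reflectBetweenSites j a x) = -sgn x) := by
  set E := (torusGraph d (2 * k)).edgeFinset with hE
  -- the single-site rotation `R₁ = D² V²` (`π` about the `1`-axis): `Sˣ ↦ Sˣ`, `Sʸ ↦ -Sʸ`, `Sᶻ ↦ -Sᶻ`
  obtain ⟨V, hV, hV', hVz, hVx, hVy⟩ := exists_unitary_conj_spinZ_eq_spinX n
  obtain ⟨D, hD, hD', hDx, hDy, hDz⟩ := exists_unitary_conj_spinX_eq_neg_spinY n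
  set R₁ := D * D * (V * V) with hR₁
  have hR₁R₁ : R₁ * R₁ᴴ = 1 := by
    rw [hR₁]
    simp only [conjTranspose_mul, Matrix.mul_assoc]
    rw [← Matrix.mul_assoc V Vᴴ, hV, Matrix.one_mul, ← Matrix.mul_assoc V Vᴴ, hV, Matrix.one_mul,
      ← Matrix.mul_assoc D Dᴴ, hD, Matrix.one_mul, hD]
  have hR₁R₁' : R₁ᴴ * R₁ = 1 := by
    rw [hR₁]
    simp only [conjTranspose_mul, Matrix.mul_assoc]
    rw [← Matrix.mul_assoc Dᴴ D, hD', Matrix.one_mul, ← Matrix.mul_assoc Dᴴ D, hD', Matrix.one_mul,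
      ← Matrix.mul_assoc Vᴴ V, hV', Matrix.one_mul, hV']
  have hconj : ∀ (A B M : Matrix (Fin (n + 1)) (Fin (n + 1)) ℂ),
      A * B * M * (A * B)ᴴ = A * (B * M * Bᴴ) * Aᴴ := by
    intro A B M
    rw [conjTranspose_mul]
    simp only [Matrix.mul_assoc]
  have hR₁x : R₁ * spinX n * R₁ᴴ = spinX n := by
    rw [hR₁, hconj, hconj V V, hVx, Matrix.mul_neg, Matrix.neg_mul, hVz, hconj D D, Matrix.mul_neg,
      Matrix.neg_mul, hDx, neg_neg, hDy]
  have hR₁y : R₁ * spinY n * R₁ᴴ = -spinY n := by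
    rw [hR₁, hconj, hconj V V, hVy, hVy, hconj D D, hDy, hDx]
  have hR₁z : R₁ * SpinOperators.spinZ n * R₁ᴴ = -SpinOperators.spinZ n := by
    rw [hR₁, hconj, hconj V V, hVz, hVx, hconj D D, Matrix.mul_neg, Matrix.neg_mul, hDz,
      Matrix.mul_neg, Matrix.neg_mul, hDz]
  -- the parity of a site and the product unitary on the odd sublattice
  set ε : TorusSite d (2 * k) → ZMod 2 := fun x =>
    ∑ j, ZMod.castHom (dvd_mul_right 2 k) (ZMod 2) (x j) with hε
  set u : TorusSite d (2 * k) → Matrix (Fin (n + 1)) (Fin (n + 1)) ℂ :=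
    fun z => if ε z = 0 then 1 else R₁ with hu
  have hua : ∀ z, u z * (u z)ᴴ = 1 := by
    intro z; simp only [hu]; split_ifs
    · rw [conjTranspose_one, Matrix.mul_one]
    · exact hR₁R₁
  have hua' : ∀ z, (u z)ᴴ * u z = 1 := by
    intro z; simp only [hu]; split_ifs
    · rw [conjTranspose_one, Matrix.mul_one]
    · exact hR₁R₁'
  set sgn : TorusSite d (2 * k) → ℂ := fun z => if ε z = 0 then 1 else -1 with hsgn
  have hux : ∀ z, u z * spinX n * (u z)ᴴ = spinX n := by
    intro z; simp only [hu]; split_ifs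
    · rw [conjTranspose_one, Matrix.mul_one, Matrix.one_mul]
    · exact hR₁x
  have huy : ∀ z, u z * spinY n * (u z)ᴴ = sgn z • spinY n := by
    intro z; simp only [hu, hsgn]; split_ifs
    · rw [conjTranspose_one, Matrix.mul_one, Matrix.one_mul, one_smul]
    · rw [hR₁y, neg_one_smul]
  have huz : ∀ z, u z * SpinOperators.spinZ n * (u z)ᴴ = sgn z • SpinOperators.spinZ n := by
    intro z; simp only [hu, hsgn]; split_ifs
    · rw [conjTranspose_one, Matrix.mul_one, Matrix.one_mul, one_smul]
    · rw [hR₁z, neg_one_smul]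
  have h01 : ∀ t : ZMod 2, t = 0 ∨ t = 1 := by decide
  have hedge : ∀ e ∈ E, ∀ x y, e = s(x, y) → sgn x * sgn y = -1 := by
    intro e he x y hexy
    subst hexy
    rw [hE, SimpleGraph.mem_edgeFinset, SimpleGraph.mem_edgeSet, torusGraph_adj_iff] at he
    have key : ∀ x' : TorusSite d (2 * k), ∀ i, sgn x' * sgn (x' + Pi.single i 1) = -1 := by
      intro x' i
      have hpar : ε (x' + Pi.single i 1) = ε x' + 1 := torusParity_add_single k x' i
      simp only [hsgn, hpar]
      rcases h01 (ε x') with h0 | h1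
      · rw [if_pos h0, if_neg (by rw [h0]; decide), one_mul]
      · rw [if_neg (by rw [h1]; decide), if_pos (by rw [h1]; decide), mul_one]
    obtain ⟨-, ⟨i, rfl⟩ | ⟨i, rfl⟩⟩ := he
    · exact key x i
    · rw [mul_comm]; exact key y i
  set W := productOp u with hW
  -- conjugation of the bond operators
  have hb0 : ∀ x y : TorusSite d (2 * k), W * spinBond n 0 x y * Wᴴ = spinBond n 0 x y := by
    intro x y
    rw [hW, productOp_conj_spinBond hua hua', spinVec_zero, hux, hux, spinBond]
    rfl
  have hb1 : ∀ x y : TorusSite d (2 * k), sgn x * sgn y = -1 →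
      W * spinBond n 1 x y * Wᴴ = -spinBond n 1 x y := by
    intro x y hxy
    rw [hW, productOp_conj_spinBond hua hua', spinVec_one, huy, huy, onSite_smul', onSite_smul',
      smul_mul_smul_comm, smul_mul_smul_comm, mul_comm (sgn y) (sgn x), hxy, spinBond]
    simp only [neg_smul, one_smul]
    rw [← neg_add, smul_neg]
    rfl
  -- `W H Wᴴ = H♭(0)`
  have hHW : W * xyTorus d (2 * k) n * Wᴴ = xyRealFieldHamiltonian (2 * k) n 0 := by
    rw [xyTorus, xxzHamiltonian, xyRealFieldHamiltonian, ← hE, Matrix.mul_smul, Matrix.smul_mul,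
      Finset.mul_sum, Finset.sum_mul, Finset.smul_sum]
    refine sum_congr rfl fun e he => ?_
    induction e using Sym2.ind with
    | h x y =>
      have hs := hedge _ he x y rfl
      simp only [Sym2.lift_mk, xyRealBond, Matrix.mul_add, Matrix.add_mul, hb0, hb1 x y hs,
        Pi.zero_apply, sub_self, Complex.ofReal_zero, zero_smul, sub_zero, add_zero, ne_eq,
        OfNat.ofNat_ne_zero, not_false_eq_true, zero_pow, zero_div, Complex.ofReal_neg,
        Complex.ofReal_one, neg_smul, one_smul, neg_add, neg_neg]
  have hU : W ∈ Matrix.unitaryGroup (TensorIndex (TorusSite d (2 * k)) (n + 1)) ℂ :=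
    Matrix.mem_unitaryGroup_iff.2 (by rw [hW]; exact productOp_mul_conjTranspose hua)
  have hWW : W * Wᴴ = 1 := by rw [hW]; exact productOp_mul_conjTranspose hua
  have hWW' : Wᴴ * W = 1 := by rw [hW]; exact productOp_conjTranspose_mul hua'
  refine ⟨W, sgn, hWW, hWW', hHW, fun x => ?_, fun x => ?_, fun j a x => ?_⟩
  · rw [hW, productOp_conj_siteSpin hua, spinVec_two, huz, onSite_smul']
    rfl
  · simp only [hsgn]
    split_ifs
    · exact Or.inl rfl
    · exact Or.inr rfl
  · -- the reflection exchanges the sublattices: `ε(θx) = ε(x) + 1`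
    have hpar : ε (Torus.reflectBetweenSites j a x) = ε x + 1 := by
      have hsplit : ∀ y : TorusSite d (2 * k),
          ε y = ZMod.castHom (dvd_mul_right 2 k) (ZMod 2) (y j) +
            ∑ i ∈ univ.erase j, ZMod.castHom (dvd_mul_right 2 k) (ZMod 2) (y i) := fun y =>
        (Finset.add_sum_erase univ
          (fun i => ZMod.castHom (dvd_mul_right 2 k) (ZMod 2) (y i)) (mem_univ j)).symm
      have hθj : (Torus.reflectBetweenSites j a x) j = 2 * a + 1 - x j := by
        rw [Torus.reflectBetweenSites_apply, Function.update_self]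
      have hθi : ∀ i ∈ univ.erase j, (Torus.reflectBetweenSites j a x) i = x i := fun i hi => by
        rw [Torus.reflectBetweenSites_apply, Function.update_of_ne (ne_of_mem_erase hi)]
      rw [hsplit, hsplit x, hθj, Finset.sum_congr rfl fun i hi => by rw [hθi i hi], map_sub,
        map_add, map_mul, map_one, map_ofNat, zmod_two_reflect]
      ring
    simp only [hsgn, hpar]
    rcases h01 (ε x) with h0 | h1
    · rw [if_pos h0, if_neg (show ¬(ε x + 1 = 0) by rw [h0]; decide)]
    · rw [if_neg (show ¬(ε x = 0) by rw [h1]; decide),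
        if_pos (show ε x + 1 = 0 by rw [h1]; decide), neg_neg]

/-! ### Sums over the two halves -/

section Halves

variable (L : ℕ) [NeZero L] (j : Fin d) (a : ZMod L)

/-- **The right half is the reflection of the left half**: a sum over the complement of the left
half is the sum over the left half of the reflected summand. [folklore] -/
theorem sum_compl_torusLeftHalf (hL : Even L) {M : Type*} [AddCommMonoid M] (f : TorusSite d L → M) :
    ∑ x ∈ (torusLeftHalf L j a)ᶜ, f x =
      ∑ x ∈ torusLeftHalf L j a, f (Torus.reflectBetweenSites j a x) := by
  refine Finset.sum_bij' (fun x _ => Torus.reflectBetweenSites j a x)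
    (fun x _ => Torus.reflectBetweenSites j a x) ?_ ?_ ?_ ?_ ?_
  · intro x hx
    exact (reflectBetweenSites_mem_torusLeftHalf_iff L j a hL x).2 (Finset.mem_compl.1 hx)
  · intro x hx
    rw [Finset.mem_compl]
    intro h
    exact (reflectBetweenSites_mem_torusLeftHalf_iff L j a hL _).1 h hx
  · intro x _; exact reflectBetweenSites_reflectBetweenSites L j a x
  · intro x _; exact reflectBetweenSites_reflectBetweenSites L j a x
  · intro x _; rw [reflectBetweenSites_reflectBetweenSites]

/-- A sum over the whole torus splits into the left half and its reflection. [folklore] -/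
theorem sum_univ_eq_sum_torusLeftHalf_add (hL : Even L) {M : Type*} [AddCommMonoid M]
    (f : TorusSite d L → M) :
    ∑ x, f x = ∑ x ∈ torusLeftHalf L j a, f x +
      ∑ x ∈ torusLeftHalf L j a, f (Torus.reflectBetweenSites j a x) := by
  rw [← sum_compl_torusLeftHalf L j a hL f, Finset.sum_add_sum_compl]

/-- A sum over the left half (as a `Finset`) is the sum over the left half (as a type), with the
inclusion `torusToLeft`. [folklore] -/
theorem sum_torusLeftHalf_eq_sum_coe (hL : Even L) {M : Type*} [AddCommMonoid M]
    (g : torusLeftHalf L j a → M) :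
    ∑ x ∈ torusLeftHalf L j a, g (torusToLeft L j a hL x) = ∑ s : torusLeftHalf L j a, g s := by
  rw [← Finset.sum_coe_sort (torusLeftHalf L j a)]
  refine Fintype.sum_congr _ _ fun s => ?_
  rw [torusToLeft_of_mem L j a hL s.2]

end Halves

/-! ### The chemical-potential reflection inequality -/

section ChemPot

variable (L : ℕ) [NeZero L] (j : Fin d) (a : ZMod L) (n : ℕ)

/-- `S³_x` is a real symmetric matrix: `(S³_x)ᵀ = S³_x`. [folklore] -/
theorem siteSpin_two_transpose {Λ : Type*} [Fintype Λ] [DecidableEq Λ] (x : Λ) :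
    (siteSpin n x 2 : Op Λ (n + 1))ᵀ = siteSpin n x 2 := by
  rw [siteSpin, spinVec_two, onSite_transpose, SpinOperators.spinZ, diagonal_transpose]

/-- **Reflection positivity with a chemical potential** (ground-state form). For the quantum XY
model on the even torus of side `L ≥ 3`, planes `P = (j, a)` with left half `Λ_L`,
`X = S³_{Λ_L} - S³_{Λ∖Λ_L}` and every real `μ`:
`½ E₀(H - μX) + ½ E₀(H + μX) ≤ E₀(H - μ S³_tot)`. Kennedy–Lieb–Shastry, J. Stat. Phys. 53 (1988),
eqs. (20)–(25), with the one-body terms `∓μ ε_x S³_x` put into `A` and `B`; Dyson–Lieb–Simon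
(1978) Lemma 4.1. [folklore] -/
theorem groundEnergy_chemPot_reflect_le (hL : Even L) (hL3 : 3 ≤ L) (μ : ℝ) :
    ((xyTorus d L n - (μ : ℂ) • (∑ x ∈ torusLeftHalf L j a, siteSpin n x 2 -
          ∑ x ∈ (torusLeftHalf L j a)ᶜ, siteSpin n x 2)).groundEnergy +
        (xyTorus d L n + (μ : ℂ) • (∑ x ∈ torusLeftHalf L j a, siteSpin n x 2 -
          ∑ x ∈ (torusLeftHalf L j a)ᶜ, siteSpin n x 2)).groundEnergy) / 2 ≤
      (xyTorus d L n - (μ : ℂ) • totalSpin n 2).groundEnergy := by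
  obtain ⟨k, rfl⟩ : ∃ k, L = 2 * k := ⟨L / 2, by obtain ⟨k, hk⟩ := hL; omega⟩
  obtain ⟨W, sgn, hWW, hWW', hHW, hWz, hsgn1, hsgnθ⟩ := exists_sublatticeRotation (d := d) k n
  have hU : W ∈ Matrix.unitaryGroup (TensorIndex (TorusSite d (2 * k)) (n + 1)) ℂ :=
    Matrix.mem_unitaryGroup_iff.2 hWW
  -- abbreviations
  set Λl := torusLeftHalf (2 * k) j a with hΛl
  set θ := Torus.reflectBetweenSites (d := d) (L := 2 * k) j a with hθ
  set LE := torusLeftEmbed (q := n + 1) (2 * k) j a hL with hLE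
  set RE := torusRightEmbed (q := n + 1) (2 * k) j a hL with hRE
  set e := torusSplit (q := n + 1) (2 * k) j a hL with he
  set A := xyLeftHamiltonian (2 * k) j a hL n 0 with hA
  set M := xyCrossOp (2 * k) j a hL n 0 with hM
  set q : Op (torusLeftHalf (2 * k) j a) (n + 1) :=
    ∑ s : torusLeftHalf (2 * k) j a, sgn (s : TorusSite d (2 * k)) • siteSpin n s 2 with hq
  set X : Op (TorusSite d (2 * k)) (n + 1) :=
    ∑ x ∈ Λl, siteSpin n x 2 - ∑ x ∈ Λlᶜ, siteSpin n x 2 with hX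
  set S : Op (TorusSite d (2 * k)) (n + 1) := totalSpin n 2 with hS
  -- (1) the Kronecker form of `H♭(0)`
  have hK0 : xyRealFieldHamiltonian (2 * k) n 0 =
      (A ⊗ₖ 1 + 1 ⊗ₖ A - ∑ i, M i ⊗ₖ M i).submatrix e e := by
    have h := xyRealFieldHamiltonian_eq_submatrix (2 * k) j a hL n 0
    have h0 : (fun y => (0 : TorusSite d (2 * k) → ℝ) (Torus.reflectBetweenSites j a y)) =
        (0 : TorusSite d (2 * k) → ℝ) := rfl
    rw [h0] at h
    exact h
  have hK0' : xyRealFieldHamiltonian (2 * k) n 0 = LE A + RE A - ∑ i, LE (M i) * RE (M i) := by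
    rw [hK0, hLE, hRE, he]
    exact submatrix_kroneckerForm (2 * k) j a hL univ A A M M
  -- (2) the rotated one-body terms: `W S³_tot Wᴴ = LE q - RE q`, `W X Wᴴ = LE q + RE q`
  have hleft : ∑ x ∈ Λl, sgn x • siteSpin n x 2 = LE q := by
    rw [hq, map_sum, ← sum_torusLeftHalf_eq_sum_coe (2 * k) j a hL]
    refine sum_congr rfl fun x hx => ?_
    rw [map_smul, torusToLeft_val_of_mem (2 * k) j a hL hx, hLE,
      ← siteSpin_eq_torusLeftEmbed n hx 2]
  have hright : ∑ x ∈ Λl, sgn (θ x) • siteSpin n (θ x) 2 = -RE q := by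
    rw [hq, map_sum, ← Finset.sum_neg_distrib, ← sum_torusLeftHalf_eq_sum_coe (2 * k) j a hL]
    refine sum_congr rfl fun x hx => ?_
    have hx' : θ x ∉ torusLeftHalf (2 * k) j a := fun h' =>
      (reflectBetweenSites_mem_torusLeftHalf_iff (2 * k) j a hL x).1 h' hx
    rw [map_smul, torusToLeft_val_of_mem (2 * k) j a hL hx, hRE,
      ← torusToLeft_reflectBetweenSites (2 * k) j a hL x, ← siteSpin_eq_torusRightEmbed n hx' 2,
      hθ, hsgnθ, neg_smul]
  have hWS : W * S * Wᴴ = LE q - RE q := by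
    rw [hS, totalSpin, Finset.mul_sum, Finset.sum_mul,
      sum_univ_eq_sum_torusLeftHalf_add (2 * k) j a hL]
    simp only [hWz]
    rw [hleft, hright, ← sub_eq_add_neg]
  have hWX : W * X * Wᴴ = LE q + RE q := by
    rw [hX, Matrix.mul_sub, Matrix.sub_mul, Finset.mul_sum, Finset.sum_mul, Finset.mul_sum,
      Finset.sum_mul, sum_compl_torusLeftHalf (2 * k) j a hL]
    simp only [hWz]
    rw [hleft, hright, sub_neg_eq_add]
  -- (3) the three rotated Hamiltonians as Kronecker forms
  have hqT : qᵀ = q := by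
    rw [hq, transpose_sum]
    refine sum_congr rfl fun s _ => ?_
    rw [transpose_smul, siteSpin_two_transpose]
  have hAT : Aᵀ = A := xyLeftHamiltonian_transpose (2 * k) j a n hL 0
  have hAmT : (A - (μ : ℂ) • q)ᵀ = A - (μ : ℂ) • q := by rw [transpose_sub, transpose_smul, hAT, hqT]
  have hApT : (A + (μ : ℂ) • q)ᵀ = A + (μ : ℂ) • q := by rw [transpose_add, transpose_smul, hAT, hqT]
  have hMT : ∀ i, (M i)ᵀ = (M i)ᴴ := fun i => xyCrossOp_transpose_eq (2 * k) j a n hL 0 i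
  have hform : ∀ (B₁ B₂ : Op (torusLeftHalf (2 * k) j a) (n + 1)),
      (B₁ ⊗ₖ 1 + 1 ⊗ₖ B₂ - ∑ i, M i ⊗ₖ M i).submatrix e e = LE B₁ + RE B₂ - ∑ i, LE (M i) * RE (M i) := by
    intro B₁ B₂
    rw [hLE, hRE, he]
    exact submatrix_kroneckerForm (2 * k) j a hL univ B₁ B₂ M M
  have hKS : W * (xyTorus d (2 * k) n - (μ : ℂ) • S) * Wᴴ =
      ((A - (μ : ℂ) • q) ⊗ₖ 1 + 1 ⊗ₖ (A + (μ : ℂ) • q) - ∑ i, M i ⊗ₖ M i).submatrix e e := by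
    rw [hform, Matrix.mul_sub, Matrix.sub_mul, hHW, hK0', Matrix.mul_smul, Matrix.smul_mul, hWS,
      map_sub, map_add, map_smul, map_smul, smul_sub]
    abel
  have hKm : W * (xyTorus d (2 * k) n - (μ : ℂ) • X) * Wᴴ =
      ((A - (μ : ℂ) • q) ⊗ₖ 1 + 1 ⊗ₖ (A - (μ : ℂ) • q) - ∑ i, M i ⊗ₖ M i).submatrix e e := by
    rw [hform, Matrix.mul_sub, Matrix.sub_mul, hHW, hK0', Matrix.mul_smul, Matrix.smul_mul, hWX,
      map_sub, map_sub, map_smul, map_smul, smul_add]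
    abel
  have hKp : W * (xyTorus d (2 * k) n + (μ : ℂ) • X) * Wᴴ =
      ((A + (μ : ℂ) • q) ⊗ₖ 1 + 1 ⊗ₖ (A + (μ : ℂ) • q) - ∑ i, M i ⊗ₖ M i).submatrix e e := by
    rw [hform, Matrix.mul_add, Matrix.add_mul, hHW, hK0', Matrix.mul_smul, Matrix.smul_mul, hWX,
      map_add, map_add, map_smul, map_smul, smul_add]
    abel
  -- (4) Hermiticity
  have hSh : S.IsHermitian := totalSpin_isHermitian n 2
  have hXh : X.IsHermitian := by
    have hs : ∀ s : Finset (TorusSite d (2 * k)),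
        (∑ x ∈ s, (siteSpin n x 2 : Op (TorusSite d (2 * k)) (n + 1))).IsHermitian := by
      intro s
      rw [IsHermitian, conjTranspose_sum]
      exact sum_congr rfl fun x _ => (siteSpin_isHermitian n x 2).eq
    rw [hX]
    exact (hs _).sub (hs _)
  have hμ : ∀ {Y : Op (TorusSite d (2 * k)) (n + 1)}, Y.IsHermitian → ((μ : ℂ) • Y).IsHermitian := by
    intro Y hY
    exact hY.smul (by rw [isSelfAdjoint_iff, Complex.star_def, Complex.conj_ofReal])
  have hHh := xyTorus_isHermitian d (2 * k) n
  have hHSh : (xyTorus d (2 * k) n - (μ : ℂ) • S).IsHermitian := hHh.sub (hμ hSh)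
  have hHmh : (xyTorus d (2 * k) n - (μ : ℂ) • X).IsHermitian := hHh.sub (hμ hXh)
  have hHph : (xyTorus d (2 * k) n + (μ : ℂ) • X).IsHermitian := hHh.add (hμ hXh)
  have herm : ∀ (Y : Op (TorusSite d (2 * k)) (n + 1)) (K : Matrix _ _ ℂ), Y.IsHermitian →
      W * Y * Wᴴ = K.submatrix e e → K.IsHermitian := by
    intro Y K hY hf
    have : K = (W * Y * Wᴴ).submatrix e.symm e.symm := by
      rw [hf, submatrix_submatrix, Equiv.self_comp_symm, submatrix_id_id]
    rw [this]
    exact (isHermitian_mul_mul_conjTranspose W hY).submatrix _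
  haveI : Nonempty ((torusLeftHalf (2 * k) j a → Fin (n + 1)) × (torusLeftHalf (2 * k) j a → Fin (n + 1))) :=
    ⟨(fun _ => 0, fun _ => 0)⟩
  -- (5) the abstract reflection positivity, transported back
  have hRP := Matrix.kls_groundEnergy_reflection (A - (μ : ℂ) • q) (A + (μ : ℂ) • q) M M hAmT hApT
    hMT hMT (herm _ _ hHSh hKS) (herm _ _ hHmh hKm) (herm _ _ hHph hKp)
  rw [← Matrix.groundEnergy_submatrix_equiv (herm _ _ hHSh hKS) e,
    ← Matrix.groundEnergy_submatrix_equiv (herm _ _ hHmh hKm) e,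
    ← Matrix.groundEnergy_submatrix_equiv (herm _ _ hHph hKp) e, ← hKS, ← hKm, ← hKp,
    Matrix.groundEnergy_unitary_conj hU, Matrix.groundEnergy_unitary_conj hU,
    Matrix.groundEnergy_unitary_conj hU] at hRP
  exact hRP

end ChemPot

end Summit.HubbardSuperconductivity.HubbardSuperconductivity.Theorems.AnisotropyChord
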